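import Literature.Analysis.Fourier.HilbertTransformLine
import Literature.NumberTheory.LFunctions.ZeroDensityIngham
import Mathlib.MeasureTheory.Measure.Haar.NormedSpace
import Mathlib.MeasureTheory.Measure.Lebesgue.Integral
import HarnessLib

/-!
# SHEET-ℝ frame: the weighted space `L²_{L²+ξ²}` embeds in `L¹`, and the half-line velocity bound

HONEST FRAMING (cell ns-blowup GROUP B / zone Z3, case Z3-SR-CERT; 1-D MODEL certificate frame; not Euler/NS).

Two elementary inequalities used by the SHEET-ℝ certificate frame (selfsim FRAME-NOTE-v2 §1 (1c); cert-1 SHEET-R-PRICE-impl1.md (E4)/(C4);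
cert-2's coverage note on p448955/p449351), both by the pointwise AM–GM bound `2|δ| ≤ t·w·δ² + (t·w)⁻¹` optimised in `t` (no Hölder machinery):

* `∫ (L² + y²)⁻¹ dy = π/L` (tree: `Literature.NumberTheory.LFunctions.ZeroDensity.integral_inv_sq_add_sq_real`), `setIntegral_Ioi_inv_sq_add_sq` — `∫_{y>0} (L² + y²)⁻¹ dy = π/(2L)`;
* `integrable_of_weighted_sq`, `integral_abs_le_of_weighted_sq` — **`L²_w ⊂ L¹`**: if `(L² + y²)·δ² ∈ L¹` and `δ` is a.e.-strongly measurable then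
  `δ ∈ L¹` and `∫|δ| ≤ (π/L)^{1/2}·(∫(L² + y²)δ²)^{1/2}` — discharges the hypothesis «`Integrable f`» of the tree's Hilbert-isometry theorems on the
  energy space `E = H¹_{L²+ξ²}` and the `L¹` clause of `exact_viscous_selfSimilar_blowup_of_profile` for a certified `E`-ball profile;
* `abs_setIntegral_le_of_weighted_sq` — **half-line velocity bound**: `|∫_{(0,ξ)} g| ≤ (π/(2L))^{1/2}·(∫_{y>0}(L² + y²)g²)^{1/2}`, and for EVEN `g`
  (`g = Hδ` of an odd `δ`, `hilbertTransform_neg_arg_of_odd`) `∫_{y>0}(L²+y²)g² = ½∫(L²+y²)g²` (`setIntegral_Ioi_eq_half_of_even`), whence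
  `|𝒰(ξ)| ≤ (π/(4L))^{1/2}·‖g‖_{L²_w}` (`abs_setIntegral_le_of_weighted_sq_even`) — FRAME-NOTE (1c)'s `0.745‖·‖_w` at `L² = 2` and PRICE-impl1 (E4)'s
  `(π/(4L))^{1/2}`.
Pure calculus; no definition, no named fact; MODEL frame bookkeeping only.
-/

noncomputable section

namespace Summit.NavierStokesRegularity.OSWSelfSimilar
namespace SheetRWeightedEmbeddings

open _root_.MeasureTheory _root_.Set _root_.Filter
open scoped Real Topology

/-! ### The weight `(L² + y²)⁻¹`: integrability and integrals -/

/-- `(L² + y²)⁻¹ = (L²)⁻¹·(1 + (y/L)²)⁻¹`. [folklore] -/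
private theorem inv_sq_add_sq_eq {L : ℝ} (hL : 0 < L) (y : ℝ) :
    (L ^ 2 + y ^ 2)⁻¹ = (L ^ 2)⁻¹ * (1 + (y / L) ^ 2)⁻¹ := by
  have hL0 : L ≠ 0 := hL.ne'
  rw [← mul_inv]
  congr 1
  field_simp

/-- `(L² + y²)⁻¹` is integrable on `ℝ` (`L > 0`). [folklore] -/
theorem integrable_inv_sq_add_sq {L : ℝ} (hL : 0 < L) : Integrable fun y : ℝ => (L ^ 2 + y ^ 2)⁻¹ := by
  have h := ((integrable_comp_div_iff (fun x : ℝ => (1 + x ^ 2)⁻¹) hL.ne').2 integrable_inv_one_add_sq).const_mul (L ^ 2)⁻¹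
  refine h.congr (Eventually.of_forall fun y => ?_)
  simp only
  rw [inv_sq_add_sq_eq hL]

/-- `∫_{y>0} (L² + y²)⁻¹ dy = π/(2L)` (the integrand is even). [folklore] -/
theorem setIntegral_Ioi_inv_sq_add_sq {L : ℝ} (hL : 0 < L) : ∫ y in Ioi (0 : ℝ), (L ^ 2 + y ^ 2)⁻¹ = π / (2 * L) := by
  have h := integral_comp_abs (f := fun y : ℝ => (L ^ 2 + y ^ 2)⁻¹)
  simp only [sq_abs] at h
  rw [Literature.NumberTheory.LFunctions.ZeroDensity.integral_inv_sq_add_sq_real hL] at h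
  have hL0 : L ≠ 0 := hL.ne'
  field_simp at h ⊢
  linarith

/-! ### `L²_w ⊂ L¹` -/

/-- Pointwise AM–GM: `|δ| ≤ (t·w·δ² + (t·w)⁻¹)/2` for `t, w > 0`. [folklore] -/
private theorem abs_le_amgm {δ w t : ℝ} (hw : 0 < w) (ht : 0 < t) :
    |δ| ≤ (t * (w * δ ^ 2) + t⁻¹ * w⁻¹) / 2 := by
  have htw : 0 < t * w := mul_pos ht hw
  have key : 2 * (t * w) * |δ| ≤ (t * w) ^ 2 * δ ^ 2 + 1 := by
    nlinarith [sq_nonneg (t * w * |δ| - 1), sq_abs δ, abs_nonneg δ]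
  rw [le_div_iff₀ (by norm_num : (0 : ℝ) < 2)]
  have h2 : t * (w * δ ^ 2) + t⁻¹ * w⁻¹ = ((t * w) ^ 2 * δ ^ 2 + 1) / (t * w) := by
    field_simp
  rw [h2, le_div_iff₀ htw]
  linarith

/-- **`L²_{L²+y²} ⊂ L¹`, integrability.** [folklore] -/
theorem integrable_of_weighted_sq {L : ℝ} (hL : 0 < L) {δ : ℝ → ℝ} (hm : AEStronglyMeasurable δ volume)
    (h0 : Integrable (fun y => (L ^ 2 + y ^ 2) * δ y ^ 2)) : Integrable δ := by
  refine ((h0.add (integrable_inv_sq_add_sq hL)).div_const 2).mono' hm (Eventually.of_forall fun y => ?_)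
  rw [Real.norm_eq_abs]
  have hw : 0 < L ^ 2 + y ^ 2 := by positivity
  have := abs_le_amgm (δ := δ y) hw one_pos
  simpa using this

/-- **`L²_{L²+y²} ⊂ L¹`, with constant:** `∫|δ| ≤ (π/L)^{1/2}·(∫(L² + y²)δ²)^{1/2}`. [folklore] -/
theorem integral_abs_le_of_weighted_sq {L : ℝ} (hL : 0 < L) {δ : ℝ → ℝ} (hm : AEStronglyMeasurable δ volume)
    (h0 : Integrable (fun y => (L ^ 2 + y ^ 2) * δ y ^ 2)) :
    ∫ y, |δ y| ≤ Real.sqrt (π / L) * Real.sqrt (∫ y, (L ^ 2 + y ^ 2) * δ y ^ 2) := by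
  set A : ℝ := ∫ y, (L ^ 2 + y ^ 2) * δ y ^ 2 with hA_def
  set B : ℝ := π / L with hB_def
  have hA0 : 0 ≤ A := integral_nonneg fun y => by positivity
  have hB0 : 0 < B := div_pos Real.pi_pos hL
  -- for every t > 0: ∫|δ| ≤ (tA + t⁻¹B)/2
  have hbound : ∀ t : ℝ, 0 < t → ∫ y, |δ y| ≤ (t * A + t⁻¹ * B) / 2 := by
    intro t ht
    have hint : Integrable fun y => (t * ((L ^ 2 + y ^ 2) * δ y ^ 2) + t⁻¹ * (L ^ 2 + y ^ 2)⁻¹) / 2 :=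
      ((h0.const_mul t).add ((integrable_inv_sq_add_sq hL).const_mul t⁻¹)).div_const 2
    have hle : ∫ y, |δ y| ≤ ∫ y, (t * ((L ^ 2 + y ^ 2) * δ y ^ 2) + t⁻¹ * (L ^ 2 + y ^ 2)⁻¹) / 2 :=
      integral_mono (integrable_of_weighted_sq hL hm h0).abs hint fun y =>
        abs_le_amgm (δ := δ y) (by positivity : (0 : ℝ) < L ^ 2 + y ^ 2) ht
    rw [integral_div, integral_add (h0.const_mul t) ((integrable_inv_sq_add_sq hL).const_mul t⁻¹), integral_const_mul,
      integral_const_mul, Literature.NumberTheory.LFunctions.ZeroDensity.integral_inv_sq_add_sq_real hL] at hle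
    exact hle
  rcases eq_or_lt_of_le hA0 with hA | hA
  · -- A = 0: let t → ∞ in the bound; equivalently ∫|δ| ≤ B/(2t) for all t, so ∫|δ| ≤ 0
    have hzero : ∫ y, |δ y| ≤ 0 := by
      by_contra hpos
      push Not at hpos
      set I : ℝ := ∫ y, |δ y| with hI
      have ht : 0 < B / I := div_pos hB0 hpos
      have := hbound (B / I) ht
      rw [← hA] at this
      have h2 : (B / I * 0 + (B / I)⁻¹ * B) / 2 = I / 2 := by
        field_simp
        ring
      rw [h2] at this
      linarith
    calc ∫ y, |δ y| ≤ 0 := hzero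
      _ ≤ Real.sqrt (π / L) * Real.sqrt A := by positivity
  · -- A > 0: optimise t = √(B/A)
    have ht : 0 < Real.sqrt (B / A) := Real.sqrt_pos.mpr (div_pos hB0 hA)
    have h := hbound _ ht
    have hsq : Real.sqrt (B / A) * A = Real.sqrt B * Real.sqrt A := by
      rw [Real.sqrt_div hB0.le, div_mul_eq_mul_div, ← Real.sqrt_sq hA.le]
      rw [Real.sqrt_sq hA.le]
      have hsA : Real.sqrt A ≠ 0 := (Real.sqrt_pos.mpr hA).ne'
      field_simp
      rw [Real.sq_sqrt hA.le]
    have hsq' : (Real.sqrt (B / A))⁻¹ * B = Real.sqrt B * Real.sqrt A := by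
      rw [Real.sqrt_div hB0.le, inv_div, div_mul_eq_mul_div]
      have hsB : Real.sqrt B ≠ 0 := (Real.sqrt_pos.mpr hB0).ne'
      field_simp
      rw [Real.sq_sqrt hB0.le]
    rw [hsq, hsq'] at h
    have : (Real.sqrt B * Real.sqrt A + Real.sqrt B * Real.sqrt A) / 2 = Real.sqrt B * Real.sqrt A := by ring
    rw [this] at h
    exact h

/-! ### The half-line velocity bound -/

/-- **Half-line bound:** if `(L² + y²)·g² ∈ L¹` (and `g` is a.e.-strongly measurable) then for every `S ⊆ (0, ∞)`,
`|∫_S g| ≤ (π/(2L))^{1/2}·(∫_{y>0}(L² + y²)g²)^{1/2}` — in particular for `S = (0, ξ)`, the velocity `𝒰(ξ) = ∫₀^ξ g`. [folklore] -/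
theorem abs_setIntegral_le_of_weighted_sq {L : ℝ} (hL : 0 < L) {g : ℝ → ℝ} (hm : AEStronglyMeasurable g volume)
    (h0 : Integrable (fun y => (L ^ 2 + y ^ 2) * g y ^ 2)) {S : Set ℝ} (hS0 : S ⊆ Ioi 0) :
    |∫ y in S, g y| ≤ Real.sqrt (π / (2 * L)) * Real.sqrt (∫ y in Ioi (0 : ℝ), (L ^ 2 + y ^ 2) * g y ^ 2) := by
  set A : ℝ := ∫ y in Ioi (0 : ℝ), (L ^ 2 + y ^ 2) * g y ^ 2 with hA_def
  set B : ℝ := π / (2 * L) with hB_def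
  have hA0 : 0 ≤ A := setIntegral_nonneg measurableSet_Ioi fun y _ => by positivity
  have hB0 : 0 < B := div_pos Real.pi_pos (by positivity)
  have hgi : Integrable g := integrable_of_weighted_sq hL hm h0
  -- |∫_S g| ≤ ∫_S |g| ≤ ∫_{Ioi 0} |g|
  have h1 : |∫ y in S, g y| ≤ ∫ y in Ioi (0 : ℝ), |g y| := by
    calc |∫ y in S, g y| ≤ ∫ y in S, |g y| := by
          have := norm_integral_le_integral_norm (μ := volume.restrict S) g
          simpa only [Real.norm_eq_abs] using this
      _ ≤ ∫ y in Ioi (0 : ℝ), |g y| :=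
          setIntegral_mono_set hgi.abs.integrableOn (Eventually.of_forall fun y => abs_nonneg _) (Eventually.of_forall hS0)
  -- for every t > 0: ∫_{Ioi 0}|g| ≤ (tA + t⁻¹B)/2
  have hbound : ∀ t : ℝ, 0 < t → ∫ y in Ioi (0 : ℝ), |g y| ≤ (t * A + t⁻¹ * B) / 2 := by
    intro t ht
    have hw0 : IntegrableOn (fun y => (L ^ 2 + y ^ 2) * g y ^ 2) (Ioi 0) := h0.integrableOn
    have hwi : IntegrableOn (fun y : ℝ => (L ^ 2 + y ^ 2)⁻¹) (Ioi 0) := (integrable_inv_sq_add_sq hL).integrableOn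
    have hint : IntegrableOn (fun y => (t * ((L ^ 2 + y ^ 2) * g y ^ 2) + t⁻¹ * (L ^ 2 + y ^ 2)⁻¹) / 2) (Ioi 0) :=
      ((hw0.const_mul t).add (hwi.const_mul t⁻¹)).div_const 2
    have hle : ∫ y in Ioi (0 : ℝ), |g y| ≤ ∫ y in Ioi (0 : ℝ), (t * ((L ^ 2 + y ^ 2) * g y ^ 2) + t⁻¹ * (L ^ 2 + y ^ 2)⁻¹) / 2 :=
      setIntegral_mono_on hgi.abs.integrableOn hint measurableSet_Ioi fun y _ =>
        abs_le_amgm (δ := g y) (by positivity : (0 : ℝ) < L ^ 2 + y ^ 2) ht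
    rw [integral_div, integral_add (hw0.const_mul t) (hwi.const_mul t⁻¹), integral_const_mul, integral_const_mul,
      setIntegral_Ioi_inv_sq_add_sq hL] at hle
    exact hle
  have hmain : ∫ y in Ioi (0 : ℝ), |g y| ≤ Real.sqrt B * Real.sqrt A := by
    rcases eq_or_lt_of_le hA0 with hA | hA
    · have hzero : ∫ y in Ioi (0 : ℝ), |g y| ≤ 0 := by
        by_contra hpos
        push Not at hpos
        set I : ℝ := ∫ y in Ioi (0 : ℝ), |g y| with hI
        have ht : 0 < B / I := div_pos hB0 hpos
        have := hbound (B / I) ht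
        rw [← hA] at this
        have h2 : (B / I * 0 + (B / I)⁻¹ * B) / 2 = I / 2 := by
          field_simp
          ring
        rw [h2] at this
        linarith
      exact hzero.trans (by positivity)
    · have ht : 0 < Real.sqrt (B / A) := Real.sqrt_pos.mpr (div_pos hB0 hA)
      have h := hbound _ ht
      have hsA : Real.sqrt A ≠ 0 := (Real.sqrt_pos.mpr hA).ne'
      have hsB : Real.sqrt B ≠ 0 := (Real.sqrt_pos.mpr hB0).ne'
      have hsq : Real.sqrt (B / A) * A = Real.sqrt B * Real.sqrt A := by
        rw [Real.sqrt_div hB0.le, div_mul_eq_mul_div]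
        field_simp
        rw [Real.sq_sqrt hA.le]
      have hsq' : (Real.sqrt (B / A))⁻¹ * B = Real.sqrt B * Real.sqrt A := by
        rw [Real.sqrt_div hB0.le, inv_div, div_mul_eq_mul_div]
        field_simp
        rw [Real.sq_sqrt hB0.le]
      rw [hsq, hsq'] at h
      linarith
  exact h1.trans hmain

/-- For an EVEN function the weighted mass on `(0, ∞)` is half the total: `∫_{y>0}(L²+y²)g² = ½∫(L²+y²)g²`. [folklore] -/
theorem setIntegral_Ioi_eq_half_of_even {L : ℝ} {g : ℝ → ℝ} (heven : ∀ y, g (-y) = g y) :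
    ∫ y in Ioi (0 : ℝ), (L ^ 2 + y ^ 2) * g y ^ 2 = 1 / 2 * ∫ y, (L ^ 2 + y ^ 2) * g y ^ 2 := by
  have h := integral_comp_abs (f := fun y : ℝ => (L ^ 2 + y ^ 2) * g y ^ 2)
  have hfun : (fun x : ℝ => (L ^ 2 + |x| ^ 2) * g |x| ^ 2) = fun x => (L ^ 2 + x ^ 2) * g x ^ 2 := by
    funext x
    rw [sq_abs]
    rcases le_or_gt 0 x with hx | hx
    · rw [abs_of_nonneg hx]
    · rw [abs_of_neg hx, heven]
  simp only [hfun] at h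
  linarith

/-- **The velocity bound of the frame** (FRAME-NOTE (1c) / PRICE-impl1 (E4)): for an EVEN `g` with `(L² + y²)·g² ∈ L¹`,
`|∫_S g| ≤ (π/(4L))^{1/2}·(∫(L² + y²)g²)^{1/2}` for every `S ⊆ (0, ∞)` — apply to `g = Hδ` (even for odd `δ`,
`Literature.Analysis.Fourier.hilbertTransform_neg_arg_of_odd`) and combine with the weighted isometry `‖Hδ‖_w = ‖δ‖_w`. [folklore] -/
theorem abs_setIntegral_le_of_weighted_sq_even {L : ℝ} (hL : 0 < L) {g : ℝ → ℝ} (hm : AEStronglyMeasurable g volume)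
    (h0 : Integrable (fun y => (L ^ 2 + y ^ 2) * g y ^ 2)) (heven : ∀ y, g (-y) = g y)
    {S : Set ℝ} (hS0 : S ⊆ Ioi 0) :
    |∫ y in S, g y| ≤ Real.sqrt (π / (4 * L)) * Real.sqrt (∫ y, (L ^ 2 + y ^ 2) * g y ^ 2) := by
  have h := abs_setIntegral_le_of_weighted_sq hL hm h0 hS0
  rw [setIntegral_Ioi_eq_half_of_even heven] at h
  have hI : 0 ≤ ∫ y, (L ^ 2 + y ^ 2) * g y ^ 2 := integral_nonneg fun y => by positivity
  calc |∫ y in S, g y| ≤ Real.sqrt (π / (2 * L)) * Real.sqrt (1 / 2 * ∫ y, (L ^ 2 + y ^ 2) * g y ^ 2) := h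
    _ = Real.sqrt (π / (4 * L)) * Real.sqrt (∫ y, (L ^ 2 + y ^ 2) * g y ^ 2) := by
        rw [Real.sqrt_mul' _ hI, ← mul_assoc, ← Real.sqrt_mul (by positivity)]
        congr 2
        field_simp
        ring

end SheetRWeightedEmbeddings
end Summit.NavierStokesRegularity.OSWSelfSimilar

end
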